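import Literature.AlgebraicGeometry.Motives.AbelianVarietyEndGaloisDescent
import Literature.AlgebraicGeometry.Motives.AbelianVarietyEndAlgebraDescent
import Literature.AlgebraicGeometry.Motives.TateAbelianFiniteLatticeProofs
import Literature.NumberTheory.DiophantineGeometry.AVIsogenyTateInjectiveProofs
import Literature.NumberTheory.DiophantineGeometry.AVGaloisModuleProofs
import Literature.NumberTheory.DiophantineGeometry.AVIsogenyTateFreeHomProofs
import Mathlib.FieldTheory.Galois.Profinite
import Mathlib.Topology.Baire.Lemmas
import Mathlib.Topology.Baire.LocallyCompactRegular
import Mathlib.RingTheory.Filtration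
import HarnessLib

/-!
# `Aut(K̄/K)` acts on `End(P_K̄)` through a finite quotient; Tate's theorem over a finite field
# from the Theorem of the Cube, Poincaré reducibility over `K̄` and finiteness of isomorphism classes

Continuation of `Motives/AbelianVarietyEndGaloisDescent` (the Galois action `σ • r = galConj σ r`
of `Aut(L/K)` on `End(P_L)`, `hfix` and Galois descent `hdesc`). This file proves the last
Galois-descent hypothesis `hΓ` of
`tate_bijective_of_finite_of_theoremOfCube_of_poincare_algebraicClosure_of_galoisDescent`
(`Motives/AbelianVarietyEndAlgebraDescent`) — the Galois group acts on `End(P_K̄)` through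
finitely many ring automorphisms — and assembles **Tate's Main Theorem over a finite field**
(J. Tate, Invent. Math. 2 (1966), Main Theorem; `tate_bijective_of_finite`,
`tate_end_bijective_of_finite` of `TateAbelianFinite`) from three inputs only: the Theorem of the
Cube (`theoremOfCube_linEquiv`, or its trust base `cechComplex_pseudoCoherent_general`), Poincaré's
complete reducibility theorem over `K̄` (`hP1`, Mumford §19 Thm. 1) and finiteness of
`K`-isomorphism classes in the relevant dimension (`finite_isoClasses_of_finite`, Milne 1986,
Cor. 18.9); the quotient fact is the theorem `exists_quotient_isogeny_holds`.

## Contents (all proved; no definition of a notion, no named fact)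

* `AbelianVariety.pointsEnd r : P(L) →* P(L)` — the action of `r ∈ End(P_L)` on `P(L)`
  transported along `P(L) ≃* P_L(L)`; `pointsEnd_galConj`: **`(σ • r)(x) = σ • r(σ⁻¹ • x)`**
  (from `toSchemeHom_galConj` and `pointsEquiv_smul_left : (σ • x)_L = Spec σ ≫ x_L ≫ gal σ`).
* `AbelianVariety.exists_eq_zsmul_of_forall_torsionPoints_self` — Milne 1986, Lemma 12.6 over an
  algebraically closed ground field with rational torsion points (the proof of
  `exists_eq_zsmul_of_forall_torsionPoints`, `AVIsogenyTateInjectiveProofs`, with `L = K`).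
* `AbelianVariety.exists_galConj_sub_eq_zsmul` — **`n`-adic continuity**: an automorphism fixing
  `P[n](L)` pointwise moves every `r ∈ End(P_L)` within `n · End(P_L)` (`L` algebraically closed).
* `finite_range_toRingHom_of_compact` — a compact group acting by ring automorphisms on a ring
  `M`, finitely generated and torsion-free over `ℤ`, `ℓ`-adically continuously (an open subgroup
  moves `M` within `ℓᵏ M`, `ℓ` a non-unit), acts through a finite quotient: fibres of the orbit
  maps are closed (`isClosed_setOf_smul_eq`, Krull's intersection theorem, Mathlib
  `Ideal.iInf_pow_smul_eq_bot_of_isTorsionFree`), stabilisers are open (`isOpen_stabilizer_of_compact`,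
  Baire: `M` is countable, Mathlib `nonempty_interior_of_iUnion_of_closed`), and the kernel, an open
  subgroup, has finite index (Mathlib `Subgroup.quotient_finite_of_isOpen`).
* `AbelianVariety.finite_range_toRingHom_galois` — **`hΓ`** for a perfect field `K`: `Gal(K̄/K)`
  is compact (Mathlib `InfiniteGalois`), stabilisers of `K̄`-points are open
  (`AlgPoints.isOpen_stabilizer`, `AVGaloisModuleProofs`), `P[ℓᵏ](K̄)` is finite
  (`finite_torsionPoints_of_cast_ne_zero`). Classically: every endomorphism of `P_K̄` is defined
  over a finite extension of `K`.
* `tate_bijective_of_finite_of_theoremOfCube_of_poincare_algebraicClosure`,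
  `tate_end_bijective_of_finite_of_theoremOfCube_of_poincare_algebraicClosure` and the
  `_of_pseudoCoherent_general_…` forms — **Tate's Main Theorem (`Hom` and `End` forms) from the
  cube, `hP1` over `K̄` and `finite_isoClasses_of_finite`**: the Galois-descent hypotheses of
  `AbelianVarietyEndAlgebraDescent` are discharged by `finite_range_toRingHom_galois`,
  `smul_end_baseChange`, `exists_end_of_baseChange_eq_of_forall_smul_eq` (finite fields are
  perfect), `End((A ⊞ B)_K̄)` being finitely generated and torsion-free by Mumford §19 Thm. 3 from
  the cube and `hP1` (`module_finite_hom_of_theoremOfCube_of_poincare`, `hsimple_of_isAlgClosed`,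
  `isTorsionFree_int_hom_of_isIsogeny_zsmul_id`, `isIsogeny_zsmul_id_of_theoremOfCube_linEquiv`).

## References

* [Tate1966Endomorphisms] J. Tate, *Endomorphisms of abelian varieties over finite fields*,
  Invent. Math. 2 (1966), 134–144, Main Theorem (statement and proof architecture as reported in
  Milne, *The Work of John Tate*, §4.3, arXiv:1210.7459, held and read).
* [Milne1986AbelianVarieties] J. S. Milne, *Abelian Varieties*, in Cornell–Silverman (1986),
  Lemma 12.6, Thm. 12.5, §16, Cor. 18.9.
* [MumfordAV1970] D. Mumford, *Abelian Varieties* (1970), §19 Thm. 1, Thm. 3.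
* [GortzWedhorn2020] U. Görtz, T. Wedhorn, *Algebraic Geometry I*, 2nd ed., (14.20), Thm. 14.86.
* [SerreGaloisCohomology1997] J.-P. Serre, *Galois Cohomology*, II.§1.1 (discrete Galois modules).

## Design

Generic topological-group statements are in the root namespace of this directory
(`Literature.AlgebraicGeometry.Motives`), the abelian-variety ones under `AbelianVariety`.
`set_option backward.isDefEq.respectTransparency false` as in the companion file.
-/

noncomputable section

universe u

open CategoryTheory CategoryTheory.Limits AlgebraicGeometry MonoidalCategory CartesianMonoidalCategory

namespace Literature.AlgebraicGeometry.Motives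

namespace AbelianVariety

open scoped MonObj Obj

set_option backward.isDefEq.respectTransparency false

variable {K : Type u} [Field K] (L : Type u) [Field L] [Algebra K L] (P : AbelianVariety K)

section PointsEnd

/-- The action of an endomorphism `r` of `P_L` on the `L`-points `P(L)` (over `K`), transported
along `P(L) ≃* P_L(L)` (`pointsMulEquiv`): `x ↦ x ≫ r`. A group homomorphism. [folklore] -/
def pointsEnd (r : P.baseChange L ⟶ P.baseChange L) : P.Points L →* P.Points L where
  toFun x := (P.pointsMulEquiv L).symm (P.pointsMulEquiv L x ≫ r.hom.hom.hom)
  map_one' := by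
    rw [map_one, MonObj.one_comp, map_one]
  map_mul' x y := by
    rw [map_mul, MonObj.mul_comp, map_mul]

/-- `pointsEnd r x` on underlying schemes: `(x_L ≫ r) ≫ pr`. [folklore] -/
theorem pointsEnd_left (r : P.baseChange L ⟶ P.baseChange L) (x : P.Points L) :
    (P.pointsEnd L r x).left =
      (P.pointsEquiv L x).left ≫ Hom.toSchemeHom r ≫ pullback.fst P.X.hom (bcSpec K L) := by
  change ((P.pointsEquiv L).symm (P.pointsEquiv L x ≫ r.hom.hom.hom)).left = _
  rw [pointsEquiv_symm_apply_left, Over.comp_left, Category.assoc]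

/-- `pointsEquiv x` is an `L`-point: its second component is the identity of `Spec L`. [folklore] -/
@[reassoc]
theorem pointsEquiv_apply_left_comp_snd (x : P.Points L) :
    (P.pointsEquiv L x).left ≫ pullback.snd P.X.hom (bcSpec K L) = 𝟙 _ := by
  have h := Over.w (P.pointsEquiv L x)
  change (P.pointsEquiv L x).left ≫ pullback.snd P.X.hom (bcSpec K L) =
    Spec.map (CommRingCat.ofHom (algebraMap L L)) at h
  rw [h, Algebra.algebraMap_self, CommRingCat.ofHom_id]
  exact Spec.map_id _

/-- **Galois twists of points and the Galois automorphisms of `P_L`**: on schemes,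
`(σ • x)_L = Spec σ ≫ x_L ≫ gal σ`. [folklore] -/
theorem pointsEquiv_smul_left (σ : L ≃ₐ[K] L) (x : P.Points L) :
    (P.pointsEquiv L (σ • x)).left = specAut L σ ≫ (P.pointsEquiv L x).left ≫ P.gal L σ := by
  apply pullback.hom_ext
  · simp only [Category.assoc, gal_fst, pointsEquiv_apply_left_comp_fst]
    rfl
  · simp only [Category.assoc, gal_snd, pointsEquiv_apply_left_comp_snd,
      pointsEquiv_apply_left_comp_snd_assoc, specAut_comp_specAut_symm]
    rfl

/-- **The Galois conjugate acts by conjugation on points**: `(σ • r)(x) = σ • r(σ⁻¹ • x)` for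
`x ∈ P(L)`. [folklore] -/
theorem pointsEnd_galConj (σ : L ≃ₐ[K] L) (r : P.baseChange L ⟶ P.baseChange L) (x : P.Points L) :
    P.pointsEnd L (P.galConj L σ r) x = σ • P.pointsEnd L r (σ⁻¹ • x) := by
  apply Over.OverMorphism.ext
  have h1 : (P.pointsEnd L (P.galConj L σ r) x).left =
      (P.pointsEquiv L x).left ≫ P.gal L σ⁻¹ ≫ Hom.toSchemeHom r ≫
        pullback.fst P.X.hom (bcSpec K L) := by
    rw [pointsEnd_left, toSchemeHom_galConj]
    simp only [Category.assoc, gal_fst]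
  have h2 : (σ • P.pointsEnd L r (σ⁻¹ • x)).left =
      specAut L σ ≫ (specAut L σ⁻¹ ≫ (P.pointsEquiv L x).left ≫ P.gal L σ⁻¹) ≫
        Hom.toSchemeHom r ≫ pullback.fst P.X.hom (bcSpec K L) := by
    rw [AlgPoints.smul_left, pointsEnd_left, pointsEquiv_smul_left]
  rw [h1, h2]
  simp only [Category.assoc]
  rw [reassoc_of% (specAut_comp_specAut_symm L σ)]

/-- `pointsEnd` is additive in `r`: `(r + s)(x) = r(x) · s(x)`. [folklore] -/
theorem pointsEnd_add (r s : P.baseChange L ⟶ P.baseChange L) (x : P.Points L) :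
    P.pointsEnd L (r + s) x = P.pointsEnd L r x * P.pointsEnd L s x := by
  change (P.pointsMulEquiv L).symm (P.pointsMulEquiv L x ≫ (r + s).hom.hom.hom) =
    (P.pointsMulEquiv L).symm (P.pointsMulEquiv L x ≫ r.hom.hom.hom) *
      (P.pointsMulEquiv L).symm (P.pointsMulEquiv L x ≫ s.hom.hom.hom)
  rw [hom_hom_hom_add, MonObj.comp_mul, map_mul]

/-- `pointsEnd (r - s) x = r(x) · s(x)⁻¹`. [folklore] -/
theorem pointsEnd_sub (r s : P.baseChange L ⟶ P.baseChange L) (x : P.Points L) :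
    P.pointsEnd L (r - s) x = P.pointsEnd L r x * (P.pointsEnd L s x)⁻¹ := by
  rw [eq_mul_inv_iff_mul_eq, ← pointsEnd_add, sub_add_cancel]

/-- `pointsEnd r` preserves the `n`-torsion. [folklore] -/
theorem pointsEnd_mem_torsionPoints (r : P.baseChange L ⟶ P.baseChange L) {n : ℤ}
    {x : P.Points L} (hx : x ∈ P.torsionPoints L n) : P.pointsEnd L r x ∈ P.torsionPoints L n := by
  rw [mem_torsionPoints_iff] at hx ⊢
  rw [← map_zpow, hx, map_one]

end PointsEnd


/-! ### A homomorphism over an algebraically closed field killing the rational `n`-torsion is divisible by `n` -/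

section Saturation

open Hom

/-- **Milne 1986, Lemma 12.6 over an algebraically closed ground field, with rational torsion
points**: if `K` is algebraically closed, `n` is invertible in `K` and `φ : A → B` kills every
point of `A[n](K)`, then `φ = n • χ`. Same proof as `exists_eq_zsmul_of_forall_torsionPoints`
(`AVIsogenyTateInjectiveProofs`, where the torsion points are taken in `A(K̄)`): `[n]_A` is a
finite étale isogeny, `Ker [n] ⊆ Ker φ` is tested on the `K`-points of the finite étale `Ker [n]`
(`Spec.hom_ext_of_forall_algHom` with `L = K`), and `[n]_A` is the quotient by its kernel.
[cite: Milne1986AbelianVarieties, Lemma 12.6 (PDF p. 191)] -/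
theorem exists_eq_zsmul_of_forall_torsionPoints_self {K : Type u} [Field K] [IsAlgClosed K]
    {A B : AbelianVariety K} (n : ℤ) (hn : (n : K) ≠ 0) (φ : A ⟶ B)
    (hφ : ∀ Q ∈ A.torsionPoints K n,
      (Q ≫ φ.hom.hom.hom : Literature.AlgebraicGeometry.Motives.specOver K K ⟶ B.X) = 1) :
    ∃ χ : A ⟶ B, φ = n • χ := by
  set f : A ⟶ A := n • 𝟙 A with hf_def
  have hf : IsIsogeny f := isIsogeny_zsmul_id_of_cast_ne_zero (A := A) n hn
  haveI : Etale (Hom.toSchemeHom f) := etale_zsmul_id_holds (A := A) n hn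
  haveI : IsFinite (Hom.toSchemeHom f) := hf.2
  set u₀ : Literature.AlgebraicGeometry.Motives.specOver K (KerAlg f) ⟶ A.X :=
    specKerAlgToKer f ≫ kerUnivPt f with hu₀_def
  have hu₀ : u₀ ∈ kerPoints _ f :=
    (kerPointsComap f (specKerAlgToKer f) ⟨_, kerUnivPt_mem f⟩).2
  have key : u₀ ≫ φ.hom.hom.hom = 1 := by
    haveI : Algebra.Etale K (KerAlg f) :=
      Literature.AlgebraicGeometry.Motives.etale_algebraMapΓ (Hom.kerToSpec f)
    apply Over.OverMorphism.ext
    apply Literature.NumberTheory.DiophantineGeometry.Spec.hom_ext_of_forall_algHom (K := K) K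
    intro ψ
    have hP : Literature.AlgebraicGeometry.Motives.AlgPoints.specOverMapOfAlgHom ψ ≫ u₀ ∈
        A.torsionPoints K n := by
      rw [torsionPoints_eq_kerPoints]
      exact (kerPointsComap f (Literature.AlgebraicGeometry.Motives.AlgPoints.specOverMapOfAlgHom ψ)
        ⟨u₀, hu₀⟩).2
    have h2 : Literature.AlgebraicGeometry.Motives.AlgPoints.specOverMapOfAlgHom ψ ≫
        (1 : Literature.AlgebraicGeometry.Motives.specOver K (KerAlg f) ⟶ B.X) = 1 :=
      MonObj.comp_one _
    have h3 := congrArg CommaMorphism.left ((hφ _ hP).trans h2.symm)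
    simp only [Over.comp_left, Category.assoc,
      Literature.AlgebraicGeometry.Motives.AlgPoints.specOverMapOfAlgHom_left] at h3 ⊢
    exact h3
  have hle : ∀ T : Literature.AlgebraicGeometry.Motives.SchemeOver K,
      kerPoints T f ≤ kerPoints T φ := by
    intro T x hx
    have hfac : kerUnivPt f = kerToSpecKerAlg f ≫ u₀ := by
      rw [hu₀_def, kerToSpecKerAlg_comp_assoc]
    rw [mem_kerPoints_iff, ← kerLiftOver_comp_kerUnivPt x hx, hfac, Category.assoc, Category.assoc,
      key, MonObj.comp_one, MonObj.comp_one]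
  obtain ⟨g, hg⟩ := IsIsogeny.exists_comp_eq_of_kerPoints_le_holds hf φ hle
  exact ⟨g, by rw [← hg, hf_def, Preadditive.zsmul_comp, Category.id_comp]⟩

end Saturation

/-! ### Elements of the pointwise stabiliser of `P[n](L)` move endomorphisms by multiples of `n` -/

section Stabiliser

variable [IsAlgClosed L]

/-- **If `γ ∈ Aut(L/K)` fixes `P[n](L)` pointwise (`L` algebraically closed, `n` invertible in
`K`), then `γ • r - r ∈ n · End(P_L)` for every `r ∈ End(P_L)`**: by `pointsEnd_galConj`,
`(γ • r - r)(x) = γ • r(γ⁻¹ • x) · r(x)⁻¹ = 1` for `x ∈ P[n](L)` (`r` preserves the `n`-torsion),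
so `γ • r - r` kills `P_L[n](L)` and Milne's Lemma 12.6 applies
(`exists_eq_zsmul_of_forall_torsionPoints_self`). This is the `n`-adic continuity of the Galois
action on `End(P_L)`. [cite: Milne1986AbelianVarieties, Lemma 12.6 (PDF p. 191)] -/
theorem exists_galConj_sub_eq_zsmul (n : ℤ) (hn : (n : K) ≠ 0) (γ : L ≃ₐ[K] L)
    (hγ : ∀ x ∈ P.torsionPoints L n, γ • x = x) (r : P.baseChange L ⟶ P.baseChange L) :
    ∃ s : P.baseChange L ⟶ P.baseChange L, P.galConj L γ r - r = n • s := by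
  refine exists_eq_zsmul_of_forall_torsionPoints_self n ((intCast_ne_zero_iff (L := L) n).mpr hn)
    _ fun Q hQ ↦ ?_
  -- `Q = x_L` for an `n`-torsion point `x ∈ P(L)`
  set x : P.Points L := (P.pointsMulEquiv L).symm Q with hx_def
  have hQx : Q = P.pointsMulEquiv L x := by rw [hx_def, MulEquiv.apply_symm_apply]
  have hx : x ∈ P.torsionPoints L n := by
    rw [mem_torsionPoints_iff] at hQ ⊢
    rw [hx_def, ← map_zpow, hQ, map_one]
  have h1 : Q ≫ (P.galConj L γ r - r).hom.hom.hom =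
      P.pointsMulEquiv L (P.pointsEnd L (P.galConj L γ r - r) x) := by
    change _ = P.pointsMulEquiv L ((P.pointsMulEquiv L).symm (P.pointsMulEquiv L x ≫ _))
    rw [MulEquiv.apply_symm_apply, hQx]
  have hγ' : γ⁻¹ • x = x := by rw [inv_smul_eq_iff, hγ x hx]
  rw [h1, pointsEnd_sub, pointsEnd_galConj, hγ', hγ _ (P.pointsEnd_mem_torsionPoints L r hx),
    mul_inv_cancel, map_one]

end Stabiliser

end AbelianVariety

/-! ### Compact groups acting `ℓ`-adically continuously on finitely generated lattices act through finite quotients -/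

section FiniteImage

variable {Γ : Type*} [Group Γ] [TopologicalSpace Γ] [IsTopologicalGroup Γ]
  {M : Type*} [Ring M] [MulSemiringAction Γ M]

/-- A subset of a topological group which is a union of left cosets of an open subgroup is
clopen. [folklore] -/
theorem isClopen_of_mul_mem_iff {S : Set Γ} {U : Subgroup Γ} (hU : IsOpen (U : Set Γ))
    (h : ∀ γ, ∀ u ∈ U, γ * u ∈ S ↔ γ ∈ S) : IsClopen S := by
  have key : ∀ T : Set Γ, (∀ γ, ∀ u ∈ U, γ * u ∈ T ↔ γ ∈ T) → IsOpen T := by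
    intro T hT
    rw [isOpen_iff_mem_nhds]
    intro γ hγ
    have hopen : IsOpen ((fun u ↦ γ * u) '' (U : Set Γ)) := (Homeomorph.mulLeft γ).isOpenMap _ hU
    refine Filter.mem_of_superset (hopen.mem_nhds ⟨1, U.one_mem, mul_one γ⟩) ?_
    rintro _ ⟨u, hu, rfl⟩
    exact (hT γ u hu).mpr hγ
  refine ⟨⟨key Sᶜ fun γ u hu ↦ ?_⟩, key S h⟩
  simp only [Set.mem_compl_iff, h γ u hu]

variable [Module.Finite ℤ M] [Module.IsTorsionFree ℤ M] (ℓ : ℤ) (hℓ : ¬ IsUnit ℓ)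
  (hcont : ∀ k : ℕ, ∃ U : Subgroup Γ, IsOpen (U : Set Γ) ∧
    ∀ γ ∈ U, ∀ r : M, ∃ s : M, γ • r - r = (ℓ ^ k) • s)
include hℓ hcont

/-- **`ℓ`-adic continuity makes the fibres of the orbit maps closed.** If a topological group
`Γ` acts on a ring `M`, finitely generated and torsion-free over `ℤ`, by ring automorphisms, and
for every `k` an open subgroup moves every element of `M` only within `ℓᵏ M` (`ℓ` a non-unit),
then `{γ | γ • r = m}` is closed: it is `⋂ₖ {γ | γ • r - m ∈ ℓᵏ M}` (Krull's intersection theorem,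
Mathlib `Ideal.iInf_pow_smul_eq_bot_of_isTorsionFree`), an intersection of unions of cosets of
open subgroups. [folklore] -/
theorem isClosed_setOf_smul_eq (r m : M) : IsClosed {γ : Γ | γ • r = m} := by
  have hsep : ∀ y : M, (∀ k : ℕ, ∃ s : M, y = (ℓ ^ k) • s) → y = 0 := by
    intro y hy
    have hI : (Ideal.span {ℓ} : Ideal ℤ) ≠ ⊤ := by rwa [Ne, Ideal.span_singleton_eq_top]
    have h := Ideal.iInf_pow_smul_eq_bot_of_isTorsionFree (M := M) (I := Ideal.span {ℓ}) hI
    have hy' : y ∈ (⨅ k : ℕ, (Ideal.span {ℓ} : Ideal ℤ) ^ k • ⊤ : Submodule ℤ M) := by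
      rw [Submodule.mem_iInf]
      intro k
      obtain ⟨s, hs⟩ := hy k
      rw [Ideal.span_singleton_pow, hs]
      exact Submodule.smul_mem_smul (Ideal.mem_span_singleton_self _) Submodule.mem_top
    rw [h] at hy'
    exact (Submodule.mem_bot ℤ).mp hy'
  have heq : {γ : Γ | γ • r = m} = ⋂ k : ℕ, {γ : Γ | ∃ s : M, γ • r - m = (ℓ ^ k) • s} := by
    ext γ
    simp only [Set.mem_setOf_eq, Set.mem_iInter]
    constructor
    · intro h k
      exact ⟨0, by rw [h, sub_self, smul_zero]⟩
    · intro h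
      exact sub_eq_zero.mp (hsep _ fun k ↦ h k)
  rw [heq]
  refine isClosed_iInter fun k ↦ ?_
  obtain ⟨U, hU, hUk⟩ := hcont k
  refine (isClopen_of_mul_mem_iff hU fun γ u hu ↦ ?_).1
  obtain ⟨s₀, hs₀⟩ := hUk u hu r
  have e : (γ * u) • r - m = (γ • r - m) + (ℓ ^ k) • (γ • s₀) := by
    rw [mul_smul, show u • r = r + (ℓ ^ k) • s₀ by rw [← hs₀, add_sub_cancel], smul_add,
      smul_comm γ (ℓ ^ k) s₀]
    abel
  simp only [Set.mem_setOf_eq, e]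
  constructor
  · rintro ⟨s, hs⟩
    exact ⟨s - γ • s₀, by rw [smul_sub, ← hs, add_sub_cancel_right]⟩
  · rintro ⟨s, hs⟩
    exact ⟨s + γ • s₀, by rw [smul_add, hs]⟩

variable [CompactSpace Γ]

/-- **Stabilisers are open** under the hypotheses of `isClosed_setOf_smul_eq`, for `Γ` compact: `Γ` is the countable union (`M` is countable) of the closed fibres `{γ | γ • r = m}`,
so one of them has an interior point (Baire), and translating it gives an interior point of the
stabiliser. [folklore] -/
theorem isOpen_stabilizer_of_compact (r : M) :
    IsOpen ((MulAction.stabilizer Γ r : Subgroup Γ) : Set Γ) := by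
  obtain ⟨n, f, hf⟩ := Module.Finite.exists_fin' ℤ M
  haveI : Countable M := hf.countable
  have hcov : ⋃ m : M, {γ : Γ | γ • r = m} = Set.univ :=
    Set.eq_univ_of_forall fun γ ↦ Set.mem_iUnion.mpr ⟨γ • r, rfl⟩
  obtain ⟨m, γ₁, hγ₁⟩ := nonempty_interior_of_iUnion_of_closed
    (fun m ↦ isClosed_setOf_smul_eq ℓ hℓ hcont r m) hcov
  have h1 : γ₁ ∈ {γ : Γ | γ • r = m} := interior_subset hγ₁
  rw [Set.mem_setOf_eq] at h1
  apply Subgroup.isOpen_of_mem_nhds _ (g := (1 : Γ))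
  have hc : Continuous fun γ : Γ ↦ γ₁ * γ := continuous_const_mul γ₁
  have hpre : (fun γ ↦ γ₁ * γ) ⁻¹' interior {γ : Γ | γ • r = m} ∈ nhds (1 : Γ) :=
    hc.continuousAt.preimage_mem_nhds (by rw [mul_one]; exact isOpen_interior.mem_nhds hγ₁)
  refine Filter.mem_of_superset hpre fun γ hγ ↦ ?_
  have h2 : γ₁ * γ ∈ {γ : Γ | γ • r = m} := interior_subset hγ
  rw [Set.mem_setOf_eq, mul_smul, ← h1] at h2
  rw [SetLike.mem_coe, MulAction.mem_stabilizer_iff]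
  exact smul_left_cancel γ₁ h2

/-- **A compact group acting `ℓ`-adically continuously by ring automorphisms on a ring
which is finitely generated and torsion-free over `ℤ` acts through a finite quotient**: the kernel
of the action is the intersection of the open stabilisers of finitely many generators, an open
subgroup, of finite index by compactness. [folklore] -/
theorem finite_range_toRingHom_of_compact :
    (Set.range (MulSemiringAction.toRingHom Γ M)).Finite := by
  obtain ⟨n, s, hs⟩ := Module.Finite.exists_fin (R := ℤ) (M := M)
  let N : Subgroup Γ := ⨅ i, MulAction.stabilizer Γ (s i)
  have hN : IsOpen (N : Set Γ) := by
    rw [Subgroup.coe_iInf]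
    exact isOpen_iInter_of_finite fun i ↦ isOpen_stabilizer_of_compact ℓ hℓ hcont (s i)
  have hfix : ∀ γ ∈ N, ∀ r : M, γ • r = r := by
    intro γ hγ r
    have hr : r ∈ Submodule.span ℤ (Set.range s) := by rw [hs]; exact Submodule.mem_top
    induction hr using Submodule.span_induction with
    | mem x hx =>
      obtain ⟨i, rfl⟩ := hx
      exact (Subgroup.mem_iInf.mp hγ i)
    | zero => exact smul_zero γ
    | add x y _ _ hx hy => rw [smul_add, hx, hy]
    | smul a x _ hx => rw [smul_comm, hx]
  haveI : Finite (Γ ⧸ N) := Subgroup.quotient_finite_of_isOpen N hN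
  have hρ : ∀ a b : Γ, QuotientGroup.leftRel N a b →
      MulSemiringAction.toRingHom Γ M a = MulSemiringAction.toRingHom Γ M b := by
    intro a b hab
    rw [QuotientGroup.leftRel_apply] at hab
    ext r
    simp only [MulSemiringAction.toRingHom_apply]
    conv_lhs => rw [← hfix _ hab r]
    rw [← mul_smul, mul_inv_cancel_left]
  let ρ' : Γ ⧸ N → (M →+* M) := Quotient.lift (MulSemiringAction.toRingHom Γ M) hρ
  refine (Set.finite_range ρ').subset ?_
  rintro _ ⟨γ, rfl⟩
  exact ⟨(QuotientGroup.mk γ : Γ ⧸ N), rfl⟩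

end FiniteImage

namespace AbelianVariety

/-! ### `hΓ`: `Aut(K̄/K)` acts on `End(P_K̄)` through a finite quotient -/

section GaloisFinite

variable {K : Type u} [Field K] [PerfectField K] (P : AbelianVariety K)

omit [PerfectField K] in
/-- There is an integer which is invertible in `K` and not a unit of `ℤ` (`2`, or `3` in
characteristic `2`). [folklore] -/
theorem exists_intCast_ne_zero_not_isUnit : ∃ ℓ : ℤ, (ℓ : K) ≠ 0 ∧ ¬ IsUnit ℓ := by
  by_cases h2 : (2 : K) = 0
  · refine ⟨3, fun h3 ↦ ?_, by rw [Int.isUnit_iff]; omega⟩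
    have e : ((3 : ℤ) : K) = (2 : K) + 1 := by norm_num
    rw [e, h2, zero_add] at h3
    exact one_ne_zero h3
  · exact ⟨2, by exact_mod_cast h2, by rw [Int.isUnit_iff]; omega⟩

/-- **`hΓ`: the Galois group of a perfect field acts on `End(P_K̄)` through finitely many ring
automorphisms**, provided `End(P_K̄)` is finitely generated and torsion-free (Mumford §19,
Thm. 3, e.g. from the Theorem of the Cube and Poincaré reducibility over `K̄`). `Gal(K̄/K)` is
compact (Mathlib `InfiniteGalois`), the action is `ℓ`-adically continuous for an integer `ℓ`
invertible in `K` (`exists_galConj_sub_eq_zsmul`: the pointwise stabiliser of the finite set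
`P[ℓᵏ](K̄)`, open by `AlgPoints.isOpen_stabilizer`, moves endomorphisms within `ℓᵏ End(P_K̄)`),
so `finite_range_toRingHom_of_compact` applies. Classically this is "every endomorphism of
`P_K̄` is defined over a finite extension of `K`" (Milne 1986, §16; Silverman, *AEC*, II §2 for
the analogous statement on isogenies). [folklore] -/
theorem finite_range_toRingHom_galois
    (hfg : Module.Finite ℤ (End (P.baseChange (AlgebraicClosure K))))
    (htf : Module.IsTorsionFree ℤ (End (P.baseChange (AlgebraicClosure K)))) :
    (Set.range (MulSemiringAction.toRingHom (AlgebraicClosure K ≃ₐ[K] AlgebraicClosure K)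
      (End (P.baseChange (AlgebraicClosure K))))).Finite := by
  haveI := hfg
  haveI := htf
  obtain ⟨ℓ, hℓK, hℓu⟩ := exists_intCast_ne_zero_not_isUnit (K := K)
  refine finite_range_toRingHom_of_compact ℓ hℓu fun k ↦ ?_
  have hn : ((ℓ ^ k : ℤ) : K) ≠ 0 := by
    rw [Int.cast_pow]
    exact pow_ne_zero _ hℓK
  haveI : Finite (P.torsionPoints (AlgebraicClosure K) (ℓ ^ k)) :=
    finite_torsionPoints_of_cast_ne_zero P (AlgebraicClosure K) (ℓ ^ k) hn
  have hS : (P.torsionPoints (AlgebraicClosure K) (ℓ ^ k) : Set (P.Points (AlgebraicClosure K))).Finite :=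
    Set.toFinite _
  refine ⟨⨅ x ∈ (P.torsionPoints (AlgebraicClosure K) (ℓ ^ k) : Set (P.Points (AlgebraicClosure K))),
    MulAction.stabilizer (AlgebraicClosure K ≃ₐ[K] AlgebraicClosure K) x, ?_, ?_⟩
  · simp only [Subgroup.coe_iInf]
    refine hS.isOpen_biInter fun x _ ↦ ?_
    exact Literature.AlgebraicGeometry.Motives.AlgPoints.isOpen_stabilizer
      (k := K) (L := AlgebraicClosure K) (X := P.X) x
  · intro γ hγ r
    have hγ' : ∀ x ∈ P.torsionPoints (AlgebraicClosure K) (ℓ ^ k), γ • x = x := fun x hx ↦ by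
      have h := Subgroup.mem_iInf.mp (Subgroup.mem_iInf.mp hγ x) hx
      exact h
    obtain ⟨s, hs⟩ := P.exists_galConj_sub_eq_zsmul (AlgebraicClosure K) (ℓ ^ k) hn γ hγ' r
    exact ⟨s, hs⟩

end GaloisFinite

end AbelianVariety

/-! ### Tate's Main Theorem over a finite field from the Theorem of the Cube, Poincaré
reducibility over `K̄` and finiteness of isomorphism classes -/

section Assembly

open AbelianVariety

variable {K : Type u} [Field K] (A B : AbelianVariety K) (ℓ : ℕ) [Fact ℓ.Prime]

/-- **Tate 1966, Main Theorem (`Hom` form) over a finite field `K`, from the Theorem of the Cube,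
Poincaré's complete reducibility theorem over `K̄`, and finiteness of `K`-isomorphism classes in
dimension `dim (A ⊞ B)`.** The Galois-descent hypotheses `hΓ`, `hfix`, `hdesc` of
`tate_bijective_of_finite_of_theoremOfCube_of_poincare_algebraicClosure_of_galoisDescent`
(`AbelianVarietyEndAlgebraDescent`) are now theorems (`finite_range_toRingHom_galois`,
`smul_end_baseChange`, `exists_end_of_baseChange_eq_of_forall_smul_eq`, for the Galois action
`instMulSemiringActionEnd`; a finite field is perfect), and the quotient fact is
`exists_quotient_isogeny_holds`; `End((A ⊞ B)_K̄)` is finitely generated and torsion-free by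
Mumford §19 Thm. 3 from the cube and `hP1` (`module_finite_hom_of_theoremOfCube_of_poincare` with
`hsimple_of_isAlgClosed`, `isTorsionFree_int_hom_of_isIsogeny_zsmul_id`).
[cite: Tate1966Endomorphisms, Main Theorem] -/
theorem tate_bijective_of_finite_of_theoremOfCube_of_poincare_algebraicClosure
    (hcube : theoremOfCube_linEquiv.{u})
    (hP1 : ∀ (X Y : AbelianVariety (AlgebraicClosure K)) (i : Y ⟶ X),
      IsClosedImmersion (Hom.toSchemeHom i) → 0 < Y.dim → Y.dim < X.dim →
      ∃ (Z : AbelianVariety (AlgebraicClosure K)) (j : Z ⟶ X),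
        IsClosedImmersion (Hom.toSchemeHom j) ∧ IsIsogeny (biprod.desc i j))
    (hfin : finite_isoClasses_of_finite K (A ⊞ B).dim) :
    tate_bijective_of_finite A B ℓ := by
  intro hK hℓ
  have hfg : Module.Finite ℤ (End ((A ⊞ B).baseChange (AlgebraicClosure K))) :=
    module_finite_hom_of_theoremOfCube_of_poincare hcube hP1
      (hsimple_of_isAlgClosed (AlgebraicClosure K)) _ _
  have htf : Module.IsTorsionFree ℤ (End ((A ⊞ B).baseChange (AlgebraicClosure K))) :=
    isTorsionFree_int_hom_of_isIsogeny_zsmul_id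
      (((A ⊞ B).baseChange (AlgebraicClosure K)).isIsogeny_zsmul_id_of_theoremOfCube_linEquiv hcube)
  exact tate_bijective_of_finite_of_theoremOfCube_of_poincare_algebraicClosure_of_galoisDescent A B ℓ
    hcube hP1 hfin (exists_quotient_isogeny_holds (A ⊞ B) ℓ)
    (Γ := AlgebraicClosure K ≃ₐ[K] AlgebraicClosure K)
    ((A ⊞ B).finite_range_toRingHom_galois hfg htf)
    (fun γ f ↦ (A ⊞ B).smul_end_baseChange (AlgebraicClosure K) γ f)
    (fun r hr ↦ (A ⊞ B).exists_end_of_baseChange_eq_of_forall_smul_eq (AlgebraicClosure K) r hr)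
    hℓ

/-- **Tate 1966, Main Theorem (`Hom` form) over a finite field — trust base after this file**:
`tate_bijective_of_finite A B ℓ` from the named fact `cechComplex_pseudoCoherent_general`
(Görtz–Wedhorn II, Thm. 23.133 / Cor. 23.135, giving the Theorem of the Cube,
`theoremOfCube_linEquiv_of_pseudoCoherent_general`), Poincaré's complete reducibility theorem over
`K̄` (`hP1`, Mumford §19 Thm. 1) and `finite_isoClasses_of_finite K (dim (A ⊞ B))`
(Milne 1986, Cor. 18.9). [cite: Tate1966Endomorphisms, Main Theorem] -/
theorem tate_bijective_of_finite_of_pseudoCoherent_general_of_poincare_algebraicClosure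
    (h : cechComplex_pseudoCoherent_general.{u})
    (hP1 : ∀ (X Y : AbelianVariety (AlgebraicClosure K)) (i : Y ⟶ X),
      IsClosedImmersion (Hom.toSchemeHom i) → 0 < Y.dim → Y.dim < X.dim →
      ∃ (Z : AbelianVariety (AlgebraicClosure K)) (j : Z ⟶ X),
        IsClosedImmersion (Hom.toSchemeHom j) ∧ IsIsogeny (biprod.desc i j))
    (hfin : finite_isoClasses_of_finite K (A ⊞ B).dim) :
    tate_bijective_of_finite A B ℓ :=
  tate_bijective_of_finite_of_theoremOfCube_of_poincare_algebraicClosure A B ℓ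
    (theoremOfCube_linEquiv_of_pseudoCoherent_general h) hP1 hfin

/-- **Tate 1966, Main Theorem (`End` form) over a finite field, from the Theorem of the Cube,
Poincaré reducibility over `K̄` and finiteness of isomorphism classes in dimension `dim (A ⊞ A)`.**
[cite: Tate1966Endomorphisms, Main Theorem] -/
theorem tate_end_bijective_of_finite_of_theoremOfCube_of_poincare_algebraicClosure
    (hcube : theoremOfCube_linEquiv.{u})
    (hP1 : ∀ (X Y : AbelianVariety (AlgebraicClosure K)) (i : Y ⟶ X),
      IsClosedImmersion (Hom.toSchemeHom i) → 0 < Y.dim → Y.dim < X.dim →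
      ∃ (Z : AbelianVariety (AlgebraicClosure K)) (j : Z ⟶ X),
        IsClosedImmersion (Hom.toSchemeHom j) ∧ IsIsogeny (biprod.desc i j))
    (hfin : finite_isoClasses_of_finite K (A ⊞ A).dim) :
    tate_end_bijective_of_finite A ℓ :=
  tate_end_bijective_of_finite_of A ℓ
    (tate_bijective_of_finite_of_theoremOfCube_of_poincare_algebraicClosure A A ℓ hcube hP1 hfin)

/-- **Tate 1966, Main Theorem (`End` form) over a finite field — the trust base of the named fact
`tate_end_bijective_of_finite A ℓ` after this file**: the pseudo-coherence of Čech complexes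
(`cechComplex_pseudoCoherent_general`, i.e. the Theorem of the Cube), Poincaré's complete
reducibility theorem over `K̄`, and finiteness of `K`-isomorphism classes of abelian varieties of
dimension `dim (A ⊞ A)` over the finite field `K`. [cite: Tate1966Endomorphisms, Main Theorem] -/
theorem tate_end_bijective_of_finite_of_pseudoCoherent_general_of_poincare_algebraicClosure
    (h : cechComplex_pseudoCoherent_general.{u})
    (hP1 : ∀ (X Y : AbelianVariety (AlgebraicClosure K)) (i : Y ⟶ X),
      IsClosedImmersion (Hom.toSchemeHom i) → 0 < Y.dim → Y.dim < X.dim →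
      ∃ (Z : AbelianVariety (AlgebraicClosure K)) (j : Z ⟶ X),
        IsClosedImmersion (Hom.toSchemeHom j) ∧ IsIsogeny (biprod.desc i j))
    (hfin : finite_isoClasses_of_finite K (A ⊞ A).dim) :
    tate_end_bijective_of_finite A ℓ :=
  tate_end_bijective_of_finite_of_theoremOfCube_of_poincare_algebraicClosure A ℓ
    (theoremOfCube_linEquiv_of_pseudoCoherent_general h) hP1 hfin

end Assembly


end Literature.AlgebraicGeometry.Motives
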